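import Summits.Ventures.LatticeQCDFlow.Scoring.TorusFreeEnergyAnalytic2D
import Summits.Ventures.LatticeQCDFlow.Scoring.SU2HaarClassAngle
import Literature.Probability.LatticeModels.BesselIDebyeAsymptotics
import Literature.Analysis.FunctionSpaces.BesselIIntegralSeries
import HarnessLib

/-!
# The weak-coupling asymptotics of the free energy density of two-dimensional `U(1)` and `SU(2)` lattice gauge theory: `f(β) = −(dim G / 2) log β + K_G + o(1)` with the EXACT constants `K_{U(1)} = −½ log 2π`, `K_{SU(2)} = −½ log 4π`

HONEST FRAMING: exact (Metropolis-corrected) sampling algorithms for lattice gauge theory;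
figures of merit are autocorrelation/cost numbers at stated couplings and volumes; no
continuum-physics claim.

Venture `LatticeQCDFlow` (cell pub-lqcd), sub-topic `Scoring`; FANOUT row 5 (`s0-sun-a`), GEN-20.
NEW WORK of the cell (placement rule).  GEN-19's `TorusFreeEnergyAnalytic2D` typed the free energy density
of two-dimensional lattice Yang–Mills at every real `β` in the Literature's S17 vocabulary
(`Literature.MathematicalPhysics.QuantumLattice.HasFreeEnergyDensity / freeEnergyDensity`):
`f_{U(N)}(β) = −Nβ + log det[I_{|i−j|}(β)]_{N×N}` and `f(β) = log z₁(β)` in general.  The Literature's named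
fact `chatterjee_freeEnergyDensity` (S17, Chatterjee JFA 2016 Thm. 1.1) is the FOUR-dimensional statement
"(i) `f(β)` exists for every `β`; (ii) `∃ c K, f(β) − c log β → K` as `β → ∞`" for `U(N)`.  This file proves
the literal TWO-dimensional counterpart of (i) ∧ (ii) for `U(1)` and for `SU(2)`, WITH THE CONSTANTS IN CLOSED
FORM, from the tree's uniform Debye asymptotics of the modified Bessel functions (Fröhlich–Spencer (B.12),
`Literature.Probability.LatticeModels.abs_besselI_mul_debye_sub_one_le`):

* §1 **`tendsto_besselI_mul_sqrt_mul_exp_neg_atTop`** — the large-argument law `I_n(x)·√(2πx)·e^{−x} → 1`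
  (`x → ∞`) for EVERY integer order `n` (DLMF 10.40.1, leading term), for the integral-defined `besselI` of
  `Literature.Analysis.FunctionSpaces` used by all row-5 oracle files; `tendsto_log_besselI_add_atTop`
  (`log I_n(x) − x + ½ log(2πx) → 0`);
* §2 `U(1)`: `det_besselI_toeplitz_fin_one`, **`unitary_one_freeEnergyDensity_two_eq`** (`f(β) = −β + log I₀(β)`,
  every real `β`), **`tendsto_unitary_one_freeEnergyDensity_two_add_log`**:
  `f_{U(1)}(β) + ½ log β → −½ log(2π)` as `β → ∞`;
* §3 `SU(2)`: **`specialUnitary_two_freeEnergyDensity_two_eq`** (`f(β) = −2β + log I₁(2β) − log β`, `β > 0`, from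
  GEN-9's `z1_su2_eq_besselI_one`), **`tendsto_specialUnitary_two_freeEnergyDensity_two_add_log`**:
  `f_{SU(2)}(β) + (3/2) log β → −½ log(4π)` as `β → ∞`;
* §4 the S17-SHAPED statements in `d = 2`: **`unitary_one_freeEnergyDensity_two_leadingTerm`** and
  **`specialUnitary_two_freeEnergyDensity_two_leadingTerm`** — `(∀ β, HasFreeEnergyDensity 2 ρ β (freeEnergyDensity 2 ρ β))
  ∧ ∃ c K, Tendsto (fun β => freeEnergyDensity 2 ρ β − c log β) atTop (𝓝 K)` for `ρ` the defining representation of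
  `U(1)` (`c = −1/2`, `K = −½ log 2π`) and of `SU(2)` (`c = −3/2`, `K = −½ log 4π`).

The coefficient of `log β` is `−(dim G)/2` (`U(1)`: `1/2`; `SU(2)`: `3/2`): one Gaussian degree of freedom per
plaquette and per generator, the two-dimensional theory being ultralocal (GEN-19 (24)).  NOT CLAIMED: `U(N)` /
`SU(N)` for `N ≥ 2` / `N ≥ 3` (`-- TODO(general form)`: for `U(N)`, `f_N(β) + (N²/2) log β → log ∏_{j<N} j! − (N/2) log 2π`
by Laplace's method on Weyl's integral and Mehta's Gaussian integral — not in the tree); nothing in `d ≥ 3`; no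
identification with Chatterjee's four-dimensional constants.  No `def`, nothing cited as a fact, 0 sorry.
-/

noncomputable section

open Real MeasureTheory Filter Topology
open Literature.MathematicalPhysics.QuantumLattice (fundamentalRep unitaryFundamentalRep continuous_fundamentalRep
  continuous_unitaryFundamentalRep HasFreeEnergyDensity freeEnergyDensity hasFreeEnergyDensity_freeEnergyDensity)
open Literature.Analysis.FunctionSpaces (besselI besselI_eq_latticeModels_besselI)
open Summit.Ventures.LatticeQCDFlow.Theory2.Lattice

namespace Summit.Ventures.LatticeQCDFlow.Scoring

/-! ### 1. `I_n(x) ~ e^x / √(2πx)` as `x → ∞`, every integer order -/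

/-- The Debye quantity of the tree's asymptotics at natural order `n` and argument `x > 0` tends to `1`:
`I_n(x)·√(2π√(x²+n²))·e^{n sinh⁻¹(n/x) − √(x²+n²)} → 1` as `x → ∞` (relative error `≤ 50/x`). -/
theorem tendsto_besselI_debye_atTop (n : ℕ) :
    Tendsto (fun x : ℝ => Literature.Probability.LatticeModels.besselI (n : ℤ) x *
        (√(2 * π * √(x ^ 2 + (n : ℝ) ^ 2)) *
          Real.exp (n * Real.arsinh (n / x) - √(x ^ 2 + (n : ℝ) ^ 2)))) atTop (𝓝 1) := by
  rw [← tendsto_sub_nhds_zero_iff]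
  have h50 : Tendsto (fun x : ℝ => (50 : ℝ) / x) atTop (𝓝 0) := tendsto_const_nhds.div_atTop tendsto_id
  refine squeeze_zero_norm' ?_ h50
  filter_upwards [eventually_gt_atTop (0 : ℝ)] with x hx
  have h := Literature.Probability.LatticeModels.abs_besselI_mul_debye_sub_one_le hx (n : ℤ)
  simp only [Int.cast_natCast] at h
  rw [Real.norm_eq_abs]
  refine h.trans ?_
  have hxs : x ≤ √(x ^ 2 + (n : ℝ) ^ 2) := Real.le_sqrt_of_sq_le (by nlinarith)
  exact div_le_div_of_nonneg_left (by norm_num) hx hxs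

/-- `√(x² + n²) − x → 0` as `x → ∞`. -/
theorem tendsto_sqrt_sq_add_sq_sub_atTop (n : ℕ) :
    Tendsto (fun x : ℝ => √(x ^ 2 + (n : ℝ) ^ 2) - x) atTop (𝓝 0) := by
  have hb : Tendsto (fun x : ℝ => (n : ℝ) ^ 2 / x) atTop (𝓝 0) := tendsto_const_nhds.div_atTop tendsto_id
  refine squeeze_zero' ?_ ?_ hb
  · filter_upwards [eventually_gt_atTop (0 : ℝ)] with x hx
    exact sub_nonneg.2 (Real.le_sqrt_of_sq_le (by nlinarith))
  · filter_upwards [eventually_gt_atTop (0 : ℝ)] with x hx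
    set s := √(x ^ 2 + (n : ℝ) ^ 2) with hs
    have hs0 : 0 ≤ s := Real.sqrt_nonneg _
    have hs2 : s ^ 2 = x ^ 2 + (n : ℝ) ^ 2 := Real.sq_sqrt (by positivity)
    have hxs : x ≤ s := Real.le_sqrt_of_sq_le (by nlinarith)
    -- `(s - x)(s + x) = n²` and `s + x ≥ x`
    rw [le_div_iff₀ hx]
    nlinarith

/-- `x / √(x² + n²) → 1` as `x → ∞`. -/
theorem tendsto_div_sqrt_sq_add_sq_atTop (n : ℕ) :
    Tendsto (fun x : ℝ => x / √(x ^ 2 + (n : ℝ) ^ 2)) atTop (𝓝 1) := by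
  -- `√(x²+n²)/x = √(1 + (n/x)²) → 1`, then invert
  have h1 : Tendsto (fun x : ℝ => √(1 + ((n : ℝ) / x) ^ 2)) atTop (𝓝 1) := by
    have h0 : Tendsto (fun x : ℝ => (n : ℝ) / x) atTop (𝓝 0) := tendsto_const_nhds.div_atTop tendsto_id
    have h2 : Tendsto (fun x : ℝ => 1 + ((n : ℝ) / x) ^ 2) atTop (𝓝 1) := by
      simpa using (tendsto_const_nhds (x := (1 : ℝ))).add (h0.pow 2)
    simpa using h2.sqrt
  have heq : (fun x : ℝ => x / √(x ^ 2 + (n : ℝ) ^ 2)) =ᶠ[atTop] fun x => (√(1 + ((n : ℝ) / x) ^ 2))⁻¹ := by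
    filter_upwards [eventually_gt_atTop (0 : ℝ)] with x hx
    have hx2 : x ^ 2 + (n : ℝ) ^ 2 = x ^ 2 * (1 + ((n : ℝ) / x) ^ 2) := by
      field_simp
    rw [hx2, Real.sqrt_mul (by positivity), Real.sqrt_sq hx.le, div_mul_eq_div_div, div_self hx.ne', one_div]
  rw [tendsto_congr' heq]
  simpa using h1.inv₀ one_ne_zero

/-- **`I_n(x) ~ e^x/√(2πx)`** (DLMF 10.40.1, leading term): for every `n ∈ ℕ`,
`I_n(x)·√(2πx)·e^{−x} → 1` as `x → ∞`, for the integral-defined `besselI` of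
`Literature.Analysis.FunctionSpaces` (from the tree's uniform Debye asymptotics, Fröhlich–Spencer (B.12)). -/
theorem tendsto_besselI_mul_sqrt_mul_exp_neg_atTop (n : ℕ) :
    Tendsto (fun x : ℝ => besselI n x * √(2 * π * x) * Real.exp (-x)) atTop (𝓝 1) := by
  have hD := tendsto_besselI_debye_atTop n
  have hR : Tendsto (fun x : ℝ => √(x / √(x ^ 2 + (n : ℝ) ^ 2))) atTop (𝓝 1) := by
    simpa using (tendsto_div_sqrt_sq_add_sq_atTop n).sqrt
  have hA : Tendsto (fun x : ℝ => (n : ℝ) * Real.arsinh (n / x)) atTop (𝓝 0) := by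
    have h0 : Tendsto (fun x : ℝ => (n : ℝ) / x) atTop (𝓝 0) := tendsto_const_nhds.div_atTop tendsto_id
    have h1 : Tendsto (fun x : ℝ => Real.arsinh (n / x)) atTop (𝓝 0) := by
      have h := (Real.continuous_arsinh.tendsto 0).comp h0
      simpa [Function.comp_def] using h
    simpa using h1.const_mul (n : ℝ)
  have hE : Tendsto (fun x : ℝ => Real.exp ((√(x ^ 2 + (n : ℝ) ^ 2) - x) - n * Real.arsinh (n / x)))
      atTop (𝓝 1) := by
    have h := ((tendsto_sqrt_sq_add_sq_sub_atTop n).sub hA)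
    rw [sub_zero] at h
    have h' := (Real.continuous_exp.tendsto 0).comp h
    simpa [Function.comp_def] using h'
  have hall := hD.mul (hR.mul hE)
  rw [one_mul, one_mul] at hall
  refine hall.congr' ?_
  filter_upwards [eventually_gt_atTop (0 : ℝ)] with x hx
  set s := √(x ^ 2 + (n : ℝ) ^ 2) with hs
  have hxs : x ≤ s := Real.le_sqrt_of_sq_le (by nlinarith)
  have hs0 : 0 < s := lt_of_lt_of_le hx hxs
  have hsqrt : √(2 * π * x) = √(2 * π * s) * √(x / s) := by
    rw [← Real.sqrt_mul (by positivity)]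
    congr 1
    field_simp
  have hexp : Real.exp (-x) =
      Real.exp (n * Real.arsinh (n / x) - s) * Real.exp ((s - x) - n * Real.arsinh (n / x)) := by
    rw [← Real.exp_add]
    congr 1
    ring
  rw [besselI_eq_latticeModels_besselI, hsqrt, hexp]
  ring

/-- Logarithmic form: **`log I_n(x) − x + ½ log(2πx) → 0`** as `x → ∞`, every `n ∈ ℕ`. -/
theorem tendsto_log_besselI_add_atTop (n : ℕ) :
    Tendsto (fun x : ℝ => Real.log (besselI n x) - x + Real.log (2 * π * x) / 2) atTop (𝓝 0) := by
  have h := (tendsto_besselI_mul_sqrt_mul_exp_neg_atTop n).log one_ne_zero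
  rw [Real.log_one] at h
  refine h.congr' ?_
  filter_upwards [eventually_gt_atTop (0 : ℝ)] with x hx
  have hI : 0 < besselI n x := by
    rw [besselI_eq_latticeModels_besselI]
    exact Literature.Probability.LatticeModels.besselI_pos hx _
  have h2 : 0 < √(2 * π * x) := Real.sqrt_pos.2 (by positivity)
  rw [Real.log_mul (mul_pos hI h2).ne' (Real.exp_pos _).ne', Real.log_mul hI.ne' h2.ne', Real.log_exp,
    Real.log_sqrt (by positivity)]
  ring

/-! ### 2. `U(1)`: `f(β) = −β + log I₀(β)` and `f(β) + ½ log β → −½ log(2π)` -/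

/-- The `1 × 1` Bessel–Toeplitz determinant is `I₀`. -/
theorem det_besselI_toeplitz_fin_one (β : ℝ) :
    (Matrix.of fun i j : Fin 1 => besselI ((i : ℤ) - (j : ℤ)).natAbs β).det = besselI 0 β := by
  rw [Matrix.det_unique]
  simp

/-- **The free energy density of two-dimensional `U(1)` lattice gauge theory: `f(β) = −β + log I₀(β)`** for every real
`β` (GEN-19's `U(N)` formula at `N = 1`; the S17 vocabulary `freeEnergyDensity 2 ρ β`). -/
theorem unitary_one_freeEnergyDensity_two_eq (β : ℝ) :
    freeEnergyDensity 2 (unitaryFundamentalRep (Fin 1) ℂ) β = -β + Real.log (besselI 0 β) := by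
  rw [freeEnergyDensity_two_unitary_eq 1 β, det_besselI_toeplitz_fin_one]
  simp

/-- **WEAK-COUPLING ASYMPTOTICS OF THE 2-d `U(1)` FREE ENERGY**: `f_{U(1)}(β) + ½ log β → −½ log(2π)` as `β → ∞`
(`I₀(β) ~ e^β/√(2πβ)`): `f(β) = −½ log β − ½ log 2π + o(1)`. -/
theorem tendsto_unitary_one_freeEnergyDensity_two_add_log :
    Tendsto (fun β : ℝ => freeEnergyDensity 2 (unitaryFundamentalRep (Fin 1) ℂ) β + Real.log β / 2)
      atTop (𝓝 (-(Real.log (2 * π) / 2))) := by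
  have h := tendsto_log_besselI_add_atTop 0
  have h2 := h.sub_const (Real.log (2 * π) / 2)
  rw [zero_sub] at h2
  refine h2.congr' ?_
  filter_upwards [eventually_gt_atTop (0 : ℝ)] with β hβ
  rw [unitary_one_freeEnergyDensity_two_eq, Real.log_mul (by positivity) hβ.ne']
  ring

/-! ### 3. `SU(2)`: `f(β) = −2β + log I₁(2β) − log β` and `f(β) + (3/2) log β → −½ log(4π)` -/

/-- **The free energy density of two-dimensional `SU(2)` lattice gauge theory: `f(β) = −2β + log I₁(2β) − log β`**
for `β > 0` (GEN-19's `freeEnergyDensity 2 ρ β = log z₁(β)` and GEN-9's `z₁(β) = e^{−2β} I₁(2β)/β`). -/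
theorem specialUnitary_two_freeEnergyDensity_two_eq {β : ℝ} (hβ : 0 < β) :
    freeEnergyDensity 2 (fundamentalRep (Fin 2)) β =
      -(2 * β) + Real.log (besselI 1 (2 * β)) - Real.log β := by
  have hI : 0 < besselI 1 (2 * β) := by
    rw [besselI_eq_latticeModels_besselI]
    exact Literature.Probability.LatticeModels.besselI_pos (by linarith) _
  rw [freeEnergyDensity_two_eq (fundamentalRep (Fin 2)) (continuous_fundamentalRep (Fin 2)) β,
    z1_su2_eq_besselI_one hβ.ne', ENNReal.toReal_ofReal (by positivity),
    Real.log_div (by positivity) hβ.ne', Real.log_mul (Real.exp_pos _).ne' hI.ne', Real.log_exp]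

/-- **WEAK-COUPLING ASYMPTOTICS OF THE 2-d `SU(2)` FREE ENERGY**: `f_{SU(2)}(β) + (3/2) log β → −½ log(4π)` as
`β → ∞` (`I₁(2β) ~ e^{2β}/√(4πβ)`): `f(β) = −(3/2) log β − ½ log 4π + o(1)`. -/
theorem tendsto_specialUnitary_two_freeEnergyDensity_two_add_log :
    Tendsto (fun β : ℝ => freeEnergyDensity 2 (fundamentalRep (Fin 2)) β + 3 / 2 * Real.log β)
      atTop (𝓝 (-(Real.log (4 * π) / 2))) := by
  have h := (tendsto_log_besselI_add_atTop 1).comp (tendsto_id.const_mul_atTop (two_pos : (0 : ℝ) < 2))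
  have h2 := h.sub_const (Real.log (4 * π) / 2)
  rw [zero_sub] at h2
  refine h2.congr' ?_
  filter_upwards [eventually_gt_atTop (0 : ℝ)] with β hβ
  simp only [Function.comp_apply, id_eq]
  rw [specialUnitary_two_freeEnergyDensity_two_eq hβ]
  have h4 : Real.log (2 * π * (2 * β)) = Real.log (4 * π) + Real.log β := by
    rw [show 2 * π * (2 * β) = (4 * π) * β by ring, Real.log_mul (by positivity) hβ.ne']
  rw [h4]
  ring

/-! ### 4. The S17-shaped statements in two dimensions -/

/-- **THE LEADING TERM OF THE 2-d `U(1)` FREE ENERGY, S17-SHAPED** (the literal two-dimensional, `N = 1` counterpart of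
the Literature's four-dimensional named fact `chatterjee_freeEnergyDensity`, here a THEOREM with explicit constants):
(i) the free energy density exists at every `β`; (ii) `f(β) − c log β → K` as `β → ∞` with `c = −1/2`, `K = −½ log 2π`. -/
theorem unitary_one_freeEnergyDensity_two_leadingTerm :
    (∀ β : ℝ, HasFreeEnergyDensity 2 (unitaryFundamentalRep (Fin 1) ℂ) β
        (freeEnergyDensity 2 (unitaryFundamentalRep (Fin 1) ℂ) β)) ∧
      ∃ c K : ℝ, Tendsto
        (fun β : ℝ => freeEnergyDensity 2 (unitaryFundamentalRep (Fin 1) ℂ) β - c * Real.log β) atTop (𝓝 K) := by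
  refine ⟨fun β => hasFreeEnergyDensity_freeEnergyDensity _ ⟨_, hasFreeEnergyDensity_two_unitary 1 β⟩,
    -(1 / 2), -(Real.log (2 * π) / 2), ?_⟩
  refine tendsto_unitary_one_freeEnergyDensity_two_add_log.congr' (Eventually.of_forall fun β => ?_)
  ring

/-- **THE LEADING TERM OF THE 2-d `SU(2)` FREE ENERGY, S17-SHAPED**: (i) the free energy density exists at every
`β`; (ii) `f(β) − c log β → K` as `β → ∞` with `c = −3/2`, `K = −½ log 4π`. -/
theorem specialUnitary_two_freeEnergyDensity_two_leadingTerm :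
    (∀ β : ℝ, HasFreeEnergyDensity 2 (fundamentalRep (Fin 2)) β (freeEnergyDensity 2 (fundamentalRep (Fin 2)) β)) ∧
      ∃ c K : ℝ, Tendsto
        (fun β : ℝ => freeEnergyDensity 2 (fundamentalRep (Fin 2)) β - c * Real.log β) atTop (𝓝 K) := by
  refine ⟨fun β => hasFreeEnergyDensity_freeEnergyDensity _ ⟨_, hasFreeEnergyDensity_two_specialUnitary 2 β⟩,
    -(3 / 2), -(Real.log (4 * π) / 2), ?_⟩
  refine tendsto_specialUnitary_two_freeEnergyDensity_two_add_log.congr' (Eventually.of_forall fun β => ?_)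
  ring

-- TODO(general form): `U(N)`, every `N`: `freeEnergyDensity 2 (unitaryFundamentalRep (Fin N) ℂ) β + (N²/2) log β
--   → log (∏_{j<N} j!) − (N/2) log (2π)` (Laplace's method on Weyl's integral formula + Mehta's Gaussian integral).

end Summit.Ventures.LatticeQCDFlow.Scoring
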